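import Summits.Schanuel.Schanuel.Theorems.RootDecomp1KHeightGrading04
import Literature.NumberTheory.DiophantineGeometry.RationalFunctionHeight

/-!
# RootDecomp1KHeightMachine — lens 1, generation 53, NODE 13 «THE HEIGHT MACHINE ON THE LINE: node 12's antecedent DISCHARGED, HYPOTHESIS-FREE, on the two ℙ¹-uniformised territory classes» (RULE K-R42 (vii′), K-R44) — part 1 (RootDecomp1KHeightMachine01): §1 the input (heights under a rational function ℚ → ℚ), §2 the transfer tails

(lens-1 g53 NODE 13 HOME kernel K = HOME/decomp-schanuel-lens-1/g53/HeightMachine.lean eb09d600…, 1515 l, 171 thm + 12 def, imports tree …RootDecomp1KHeightGrading04 + Literature.NumberTheory.DiophantineGeometry.RationalFunctionHeight ONLY; Probe / Ctrl0 / Ctrl + NODE-g53.md + SHA256SUMS + the lens's K-R44 certificate g53/liveness/ (census instrument liveness3.py); CLAIM L2587, crit EX-ANTE PRICE L2588 (ONE THEOREM ×1 under RULE K-R42 (vii′) «an infinite territory class becomes UNCONDITIONAL» iff CHECKLIST K-g53; RULE K-R44 liveness certificate), NODE L2595 / REQUEST L2596, census STAGING NOTE 3 L2597 + CONFIRM L2598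 (L13 liveness row; dedup pre-scan 0 homonyms), critic VERDICT L2599: CLEARED — THEOREM ×1 under RULE K-R42 (vii′) (A⁺ ∧ A′ jointly; the (P2) label earned inside the credit by L13); CHECKLIST K-g53 met; RULE K-R44 fixed with the census instrument LIVENESS-v3 as certificate format; PORT GO (credit port, verbatim; conditions: dedup scan clean, provenance block, cite-token spelling). Port by census-1 gen 22 as `RootDecomp1KHeightMachine01–05` (`--supports stmt-Schanuel-33364`; no census credit): 01 = §1 the INPUT `exists_logHt_div_sub_le` (Silverman AEC VIII.5.6 on ℙ¹ over ℚ — the tree's PROVED Literature theorem `exists_abs_logHeight₁_div_sub_le_finrank` at k = K = ℚ through node 12's `logHt_eq_logHeight₁`; NO binder, NO hypothesis def) + §2 the two transfer tails (`clause_of_transfer`, `not_clause_of_transfer(_le)`, boundary tail `not_clause_of_upper_height_le`); 02 = §3 CLASS I correspondence curves **`thinFibreAt_of_corr`** (A⁺) / `thinFibreAt_iff_bddLevelEmpty_of_corr(_le)` (B⁺, B⁼) / `thinFibreAt_or_iff_bddLevelEmpty_of_corr` + `CorrAt`, `corrP` + §4 CLASS II ℚ-parametrised curves **`thinFibreAt_of_param`**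 (A′) / B′ / B′⁼ + `ParamAt`; 03 = §5 the class-I member `M13` (illustration; costume test at m₀ = 2, 3); 04 = §5b the LIVE class-I member `L13` (K-R44 certificate LIFTS; costume test); 05 = §6 the class-II member `R13` (x = t³ + t, y = t + 1/t; LIFTS, exp 1/3) + §7 the residual of record RE-GRADED ×0 (`MachineDecidedAt`, `MachineOffAt`, `MachineHeightOffAt`, `thinFibre_of_machineOffAt`, …). PORT EDITS: none needed on decls (K fully documented, no private, no set_option, no cite-token); provenance doc blocks + continuation headers = K's own open-lines only; statements and proofs VERBATIM. Rung 0 — nothing here proves Schanuel, 33364, 33363, 31077 or ThinFibre 2; classes I/II are HYPOTHESIS-FREE, the rest of §7 is conditional on PadicSubspace / HeightComparison.)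
-/

/-!
# RootDecomp1KHeightMachine — lens 1, generation 53, node 13 «THE HEIGHT MACHINE ON THE LINE:
  node 12's antecedent DISCHARGED, HYPOTHESIS-FREE, on the two ℙ¹-uniformised territory classes»
  (RULE K-R42 (vii′) «an infinite territory class becomes UNCONDITIONAL»; RULE K-R44 MEMBER LIVENESS; CLAIM L2587, PRICE L2588)

HONEST SCOPE (line 1).  FOUR theorems on the K-line's thin-fibre residual with NO binder, NO hypothesis `def … : Prop`, NO
Literature fact left as an assumption: the ONLY Diophantine input is the tree's FULLY PROVED Literature THEOREM
`Literature.NumberTheory.DiophantineGeometry.exists_abs_logHeight₁_div_sub_le_finrank` (the global height inequality under a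
degree-`n` rational map `ℙ¹ → ℙ¹`, Silverman AEC VIII.5.6, both halves, field-uniform) at `k = K = ℚ`, bridged to the line's
`logHt` by node 12's `logHt_eq_logHeight₁` (§1), and fed to node 12's two asymptotic inequalities `clause_of_lower_height` /
`not_clause_of_upper_height` (node 12 §2 — NOT re-proved).  Rung count 0; NO ∀-item moves: 33364 / 33363 / 31077 /
`Schanuel` UNMOVED; `ThinFibre 2` NOT proved; node 12's binder `HeightComparison` (all geometrically irreducible `P`) is NOT
discharged — only its two ℙ¹-uniformised sub-classes are; `PadicSubspace` untouched.

* THEOREM A⁺ `thinFibreAt_of_corr` (class I = CORRESPONDENCE curves `f(y) = g(x)`, any genus): `P : ℤ[X][X]`; `F₁ F₂ G₁ G₂ : ℚ[X]`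
  with `IsCoprime F₁ F₂`, `IsCoprime G₁ G₂`; the RELATION hypothesis `∀ x y : ℚ, bev P x y = 0 → aeval y F₁ * aeval x G₂ =
  aeval y F₂ * aeval x G₁` (`bev` = the tree's real evaluation at the casts `(x : ℝ), (y : ℝ)`; `aeval` = Mathlib's over `ℚ`);
  `dF = max F₁.natDegree F₂.natDegree`, `dG = max G₁.natDegree G₂.natDegree`: `dF < m₀ * dG → ThinFibreAt m₀ P` for EVERY `m₀`,
  every top `x`-coefficient (any `ℚ₂`-multiplicity, any `e`), every `x`-support.  Data over `ℤ` is the special case `corrP` /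
  `thinFibreAt_corrP` (coprimality of the `ℚ`-images; `P = F₁(Y)·G₂(x) − F₂(Y)·G₁(x)` literally).  NO `1 ≤ dF`, NO `P ≠ 0`, NO
  `Prime P`, NO `GeomIrreducible P` is assumed (not needed: `dF = 0 < m₀·dG` forces `dG ≥ 1` and then the levels are
  eventually EMPTY by the same transfer, `thinFibreAt_of_transfer`).
* THEOREM B⁺ `thinFibreAt_iff_bddLevelEmpty_of_corr` (STRICT): same data, `1 ≤ dG → 1 ≤ m₀ → m₀ * dG < dF → (ThinFibreAt m₀ P ↔
  BddLevelEmpty P)` (`↔ LevelFinite P` hypothesis-free, node 12); THEOREM B⁼ `thinFibreAt_iff_bddLevelEmpty_of_corr_le`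
  (BOUNDARY INCLUDED; exact transfer, room `(N−1)! → ∞`, §2 `not_clause_of_upper_height_le`): `1 ≤ dG → m₀ * dG ≤ dF →
  (ThinFibreAt m₀ P ↔ BddLevelEmpty P)` for EVERY `m₀` (no `1 ≤ m₀`); hence the COMPLETE DICHOTOMY
  `thinFibreAt_or_iff_bddLevelEmpty_of_corr`: `1 ≤ dG →` for every `m₀`, `ThinFibreAt m₀ P ∨ (ThinFibreAt m₀ P ↔ BddLevelEmpty P)`
  — class I has NO undecided boundary.
* THEOREM A′ `thinFibreAt_of_param` (class II = `ℚ`-PARAMETRISED curves): `φ₁ φ₂ ψ₁ ψ₂ : ℚ[X]`, `IsCoprime φ₁ φ₂`, `IsCoprime ψ₁ ψ₂`,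
  `B : ℝ`, the PARAMETRISATION hypothesis `∀ x y : ℚ, bev P x y = 0 → logHt x ≤ B ∨ ∃ t : ℚ, aeval t φ₁ / aeval t φ₂ = x ∧
  aeval t ψ₁ / aeval t ψ₂ = y` (exceptional abscissae of BOUNDED HEIGHT — a finite set `E : Finset ℚ` is the case
  `B = Σ_{e ∈ E} h(e)`, `thinFibreAt_of_param_finset`, and the checklist's reading with non-vanishing denominators INSIDE the
  conclusion is the further special case `thinFibreAt_of_param_finset'`; Mathlib's junk value `a / 0 = 0` makes the weaker
  hypothesis used here harmless: VIII.5.6 holds VERBATIM at a pole, §1): `dφ < m₀ * dψ → ThinFibreAt m₀ P`.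
* THEOREM B′ `thinFibreAt_iff_bddLevelEmpty_of_param` (STRICT): `1 ≤ m₀ → m₀ * dψ < dφ → (ThinFibreAt m₀ P ↔ BddLevelEmpty P)`;
  B′⁼ `thinFibreAt_iff_bddLevelEmpty_of_param_le` (BOUNDARY INCLUDED): `1 ≤ dψ → m₀ * dψ ≤ dφ → (ThinFibreAt m₀ P ↔ BddLevelEmpty P)`;
  COMPLETE DICHOTOMY `thinFibreAt_or_iff_bddLevelEmpty_of_param` (`1 ≤ dψ`, every `m₀`).

WHY IT BITES (the mechanism in one line).  At a rational point `(x_N, r)` of a large level, class I gives `dG·h(x_N) − C_G ≤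
h(g(x_N)) = h(f(r)) ≤ dF·h(r) + C_F` (a pole of `g` at `x_N` is impossible once `dG·h(x_N) > C_G`, because VIII.5.6 at a pole
reads `dG·h(x_N) ≤ C_G`; a pole of `f` at `r` bounds `h(r)`, hence `N`), and class II gives `dψ·h(t) − C_ψ ≤ h(r)`,
`h(x_N) ≤ dφ·h(t) + C_φ`; with `h(x_N) = N!·log 2 + O(1)` (node 12 §1) node 12 §2 decides the clause by the sign of
`dG/dF − 1/m₀` (resp. `dψ/dφ − 1/m₀`).  The GLOBAL inequality's archimedean half is load-bearing exactly on the members whose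
`ℚ₂`-fibres over `x_N` carry a LIVE branch at dyadic exponent `< 1/m₀` (RULE K-R44) — see (h2).

HONESTY (h1)–(h5), (h2) CORRECTED as ruled at PRICE L2588.
(h1) rung 0; no ∀-item moves; `ThinFibre 2` / (b) / `SB 2` / 31077 / 33364 / 33363 / `Schanuel` NOT proved and NOT derivable here.
(h2) THE 2-ADIC SHADOW.  Bookkeeping (covered by A⁺/A′ as stated, NO credit asked): polynomial `g` (two-term curves = the
  tree's `thinFibreAt_twoTermP`, K-R36 (i)) AND every member whose `ℚ₂`-fibres over `x_N` avoid the live near-root branches of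
  the top — there a 2-adic Newton polygon ALONE decides the clause.  THIS INCLUDES `M13` (§5): the critic's Newton polygon
  (L2588) and the census LIVENESS instrument (v2) show every `ℚ₂`-point of `M13` over `x_N` has `v(r) = −N!` (the `μ = 2`
  branch at `Y = 0` needs `2·v(r) = N! + 1`, parity-impossible) — `M13` is an ILLUSTRATION of A⁺, open by NAME only, and
  carries NO (P2) label; my CLAIM's «no dyadic constraint for M13» was FALSE and is withdrawn.  LIVE members (K-R44
  certificate in the memo, census instrument format): `L13` (§5b, class I, top `Y²`, `μ_ℚ₂ = 2`): the near-root branch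
  `v(r) = N!/2` over `x_N` has residual `u² − 1` and LIFTS (Hensel) — `ℚ₂`-points with `r ∈ 2^{N!/2}ℤ₂` for every `N ≥ 2`,
  dyadic exponent `0 < 1/m₀` for EVERY `m₀`: only the global/archimedean half decides — the (P2)-type witness (a live
  `μ = 2` top decided AT `m₀ = 2`); `R13` (§6, class II, top constant): `v(r) = −N!/3`, exponent `1/3 < 1/2`, LIFTS — live at
  `m₀ = 2` (critical at `m₀ = 3`), archimedean half load-bearing (`|r| ≤ C` keeps `t ≍ 1`).
(h3) MODULO `HeightComparison` nothing new is decided on geometrically irreducible members (node 12 THEOREM A covers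
  `n < m₀k`; class I/II ratios `dG/dF`, `dψ/dφ` agree with `k/n` there); the content is UNCONDITIONALITY on two infinite
  territory classes + the dichotomy B there, by an input of the global kind already formalised with a complete proof in the tree.
(h4) class II's `x`-side bound `h(t) ≥ h(x_N)/dφ − c` is locally reproducible (2-adic Liouville at the poles of `φ`); its
  global content is the `ψ`-side hard half `h(ψ(t)) ≥ dψ·h(t) − c`.
(h5) OPEN BY NAME after node 13: `HeightComparison` itself (all geometrically irreducible `P`: Weil–Siegel on the Jacobian
  side, out of reach in the tree), `PadicSubspace` (node 11), the territory outside classes I/II (no map to a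
  ℙ¹-correspondence `f(y) = g(x)` and no `ℚ`-parametrisation: generic genus `≥ 1`) — the BOUNDARY `dF = m₀·dG` /
  `dφ = m₀·dψ` is NOT open: it lies on the dichotomy side (B⁼ / B′⁼, `1 ≤ dG` / `1 ≤ dψ`) —, members 2-adically dead
  near the multiple roots of the top (bookkeeping, open by name: `M13`), and
  non-geometrically-irreducible primes outside classes I/II.

§1 the input bridged (`abs_logHt_div_sub_le`, pole reading `logHt_le_of_pole`) · §2 the two tails through node 12 §2
(`thinFibreAt_of_transfer`, `bddLevelEmpty_of_thinFibreAt_of_transfer`; boundary tail `not_clause_of_upper_height_le`,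
`bddLevelEmpty_of_thinFibreAt_of_transfer_le` — NEW arithmetic, no ε) · §3 class I: `corr_transfer`, THEOREMS A⁺/B⁺/B⁼ +
the complete dichotomy `thinFibreAt_or_iff_bddLevelEmpty_of_corr`, the
class predicate `CorrAt m₀` ([class] def, consumed ONLY by `thinFibreAt_of_corrAt` = A⁺ restated), the `ℤ`-data family
`corrP` · §4 class II: `param_transfer`, THEOREMS A′/B′/B′⁼ (+ `Finset` forms, dichotomy), `ParamAt m₀` · §5 the member `M13 = x²Y² + x(Y³+2)
+ (2Y³+Y²+4)` (class I, `dF = 3 < 2·2`; costume test by name at `m₀ = 2, 3`; 2-adically DEAD near `Y = 0`: ILLUSTRATION) ·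
§5b the LIVE member `L13 = x²Y² − x(Y³ − 2Y² + 1) + 3Y² = (Y³+1)(x²+x+3) − (Y³−Y²+1)(x²+2x+3)` (class I, `dF = 3 < 2·2`, top
`Y²`, LIVE near `Y = 0`: the TERRITORY WITNESS; costume test by name: `¬ DecidedAt 2`, `¬ DecidedAt 3` disjunct by disjunct,
`¬ SepTopAt m₀ ∀ m₀`, `¬ RootlessTop e ∀ e`, `≠ twoTermP k B A ∀`, `≠ xLinP A B ∀`, `≠ B17P, N2P, cuspP`, `thinThreshold = 5`)
· §6 the LIVE class-II member `R13 = x² − x(Y³ − 2Y) + Y²` (`x = t³ + t`, `y = t + 1/t`, inverse `t = (x+y)/y²`, `B = 0`;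
`dφ = 3 < 2·2`; top constant, `e = 3`, `thinThreshold = 4`, `RootlessTop e` only from `e = 3`) · §7 node 12's graded residual
RE-STATED with classes I/II removed from the `HeightComparison`-dependence (bookkeeping ×0, said so):
`ThinFibre m₀ ⟸ MachineOffAt m₀` (2 ≤ m₀; hyp-free on `CorrAt ∨ ParamAt`, tree elsewhere) and
`ThinFibre m₀ ⟸ PadicSubspace ∧ HeightComparison ∧ MachineHeightOffAt m₀`.
Imports: tree `…RootDecomp1KHeightGrading04` (node 12/12b port; brings HeightGrading01–03, SubspaceBranch04, LevelFinite,
XAll, XTop, XLinear) + `Literature.NumberTheory.DiophantineGeometry.RationalFunctionHeight` ONLY.  `logHt`, `xQ`,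
`BddLevelEmpty`, `HeightComparison`, `clause_of_lower_height`, `not_clause_of_upper_height` are node 12's, reused BY NAME;
`CorrAt`, `ParamAt`, `corrP`, `MachineDecidedAt`, `MachineOffAt`, `MachineHeightOffAt`, `M13`, `L13`, `R13` are new and
namespaced here (dedup `rg` vs the tree in the memo).
-/

noncomputable section

namespace Summit.Schanuel.Schanuel.Theorems.RootDecomp1KHeightMachine

open Polynomial LiouvilleNumber
open scoped Nat
open Summit.Schanuel.Schanuel.Theorems.RootDecomp1KSkelCell (SkelLiouvilleFix)
open Summit.Schanuel.Schanuel.Theorems.RootDecomp1KTwoBaseCell (psNumer partialSum_eq_psNumer_div coprime_psNumer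
  partialSum_pos' partialSum_lt_two)
open Summit.Schanuel.Schanuel.Theorems.RootDecomp1KDegreeLadder
open Summit.Schanuel.Schanuel.Theorems.RootDecomp1KXLinearCore
open Summit.Schanuel.Schanuel.Theorems.RootDecomp1KXLinear
open Summit.Schanuel.Schanuel.Theorems.RootDecomp1KXLinearII
open Summit.Schanuel.Schanuel.Theorems.RootDecomp1KXTop
open Summit.Schanuel.Schanuel.Theorems.RootDecomp1KXAll
open Summit.Schanuel.Schanuel.Theorems.RootDecomp1KLevelFinite
open Summit.Schanuel.Schanuel.Theorems.RootDecomp1KSubspaceBranch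
open Summit.Schanuel.Schanuel.Theorems.RootDecomp1KHeightGrading

/-! ### §1  The input: heights under a rational function `ℚ → ℚ` (Literature, Silverman AEC VIII.5.6 on `ℙ¹`), in the line's `logHt` -/

/-- **THE INPUT, bridged** — for coprime `p, q ∈ ℚ[t]` with `max(deg p, deg q) = n` there is `C` with
`|h(p(t)/q(t)) − n·h(t)| ≤ C` for every `t ∈ ℚ` (`h = logHt`; at a zero of `q` the quotient is `0`, `h(0) = 0`, and the
inequality holds verbatim).  This is the tree's FULLY PROVED Literature theorem
`Literature.NumberTheory.DiophantineGeometry.exists_abs_logHeight₁_div_sub_le_finrank` (the global height inequality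
under a degree-`n` map `ℙ¹ → ℙ¹`, both halves; field-uniform form) at `k = K = ℚ` (`[ℚ:ℚ] = 1`), rewritten through
node 12's `logHt_eq_logHeight₁`. -/
theorem abs_logHt_div_sub_le {p q : ℚ[X]} (hpq : IsCoprime p q) {n : ℕ} (hp : p.natDegree ≤ n)
    (hq : q.natDegree ≤ n) (hn : p.natDegree = n ∨ q.natDegree = n) :
    ∃ C : ℝ, ∀ t : ℚ, |logHt (aeval t p / aeval t q) - n * logHt t| ≤ C := by
  obtain ⟨C, hC⟩ :=
    Literature.NumberTheory.DiophantineGeometry.exists_abs_logHeight₁_div_sub_le_finrank hpq hp hq hn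
  refine ⟨C, fun t => ?_⟩
  have h := hC ℚ t
  rw [Module.finrank_self, Nat.cast_one, mul_one] at h
  rwa [logHt_eq_logHeight₁, logHt_eq_logHeight₁]

/-- the one-sided forms: `n·h(t) − C ≤ h(p(t)/q(t)) ≤ n·h(t) + C`. -/
theorem logHt_div_bounds {p q : ℚ[X]} (hpq : IsCoprime p q) {n : ℕ} (hp : p.natDegree ≤ n)
    (hq : q.natDegree ≤ n) (hn : p.natDegree = n ∨ q.natDegree = n) :
    ∃ C : ℝ, ∀ t : ℚ, (n : ℝ) * logHt t - C ≤ logHt (aeval t p / aeval t q) ∧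
      logHt (aeval t p / aeval t q) ≤ n * logHt t + C := by
  obtain ⟨C, hC⟩ := abs_logHt_div_sub_le hpq hp hq hn
  refine ⟨C, fun t => ?_⟩
  have h := abs_le.mp (hC t)
  constructor <;> linarith [h.1, h.2]

/-- a pole of `p/q` has bounded height: `q(t) = 0 ⇒ n·h(t) ≤ C` (the quotient is `0` and `h(0) = 0`). -/
theorem logHt_le_of_pole {p q : ℚ[X]} {n : ℕ} {C : ℝ}
    (hC : ∀ t : ℚ, (n : ℝ) * logHt t - C ≤ logHt (aeval t p / aeval t q) ∧
      logHt (aeval t p / aeval t q) ≤ n * logHt t + C)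
    {t : ℚ} (ht : aeval t q = 0) : (n : ℝ) * logHt t ≤ C := by
  have h := (hC t).1
  rw [ht, div_zero, logHt_zero] at h
  linarith

/-- coprime polynomials have no common root (`a·p + b·q = 1` evaluated at the root). -/
theorem ne_zero_of_isCoprime_of_eq_zero {p q : ℚ[X]} (hpq : IsCoprime p q) {t : ℚ} (hq : aeval t q = 0) :
    aeval t p ≠ 0 := by
  intro hp
  obtain ⟨a, b, hab⟩ := hpq
  have h := congrArg (aeval t) hab
  rw [map_add, map_mul, map_mul, hp, hq, mul_zero, mul_zero, add_zero, map_one] at h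
  exact zero_ne_one h

/-- `ℤ[t] → ℚ[t]` does not change evaluation at rational points … -/
theorem aeval_mapQ (F : ℤ[X]) (t : ℚ) : aeval t (F.map (Int.castRingHom ℚ)) = aeval t F := by
  rw [← algebraMap_int_eq, aeval_map_algebraMap]

/-- … nor the degree. -/
theorem natDegree_mapQ (F : ℤ[X]) : (F.map (Int.castRingHom ℚ)).natDegree = F.natDegree :=
  natDegree_map_eq_of_injective (Int.castRingHom ℚ).injective_int F

/-! ### §2  The two tails: a TRANSFER INEQUALITY along the curve decides the clause (tree arithmetic of node 12 §2) -/

/-- **lower tail** — if at every rational point `(x_N, r)` of every large level `k·h(x_N) − c ≤ n·h(r)`, then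
`n < m₀·k ⇒ ThinFibreAt m₀ P` (for `n = 0` the inequality fails at every point of a large level: no points). -/
theorem thinFibreAt_of_transfer {P : ℤ[X][X]} {n k : ℕ} {c : ℝ} {N₁ : ℕ}
    (htr : ∀ N : ℕ, N₁ ≤ N → ∀ r : ℚ, bev P (partialSum 2 N) r = 0 →
      (k : ℝ) * logHt (xQ N) - c ≤ n * logHt r)
    {m₀ : ℕ} (hlt : n < m₀ * k) : ThinFibreAt m₀ P := by
  intro C
  have hk : 1 ≤ k := by
    rcases Nat.eq_zero_or_pos k with h | h
    · subst h; simp at hlt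
    · exact h
  have hk0 : (0 : ℝ) ≤ k := Nat.cast_nonneg k
  have hk1 : (1 : ℝ) ≤ k := by exact_mod_cast hk
  rcases Nat.eq_zero_or_pos n with hn0 | hn
  · subst hn0
    obtain ⟨N₂, hN₂⟩ := eventually_le_factorial_log (c + 1)
    refine ⟨max (max N₁ N₂) 2, fun N hN r _ hroot _ => ?_⟩
    exfalso
    have hN1 : N₁ ≤ N := le_trans (le_trans (le_max_left _ _) (le_max_left _ _)) hN
    have hN2 : N₂ ≤ N := le_trans (le_trans (le_max_right _ _) (le_max_left _ _)) hN
    have h2 : 2 ≤ N := le_trans (le_max_right _ _) hN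
    have h := htr N hN1 r hroot
    have hx := le_logHt_xQ h2
    have hB := hN₂ N hN2
    have hL0 : 0 ≤ (N ! : ℝ) * Real.log 2 := by positivity
    simp only [Nat.cast_zero, zero_mul] at h
    have e1 : 1 * logHt (xQ N) ≤ (k : ℝ) * logHt (xQ N) := mul_le_mul_of_nonneg_right hk1 (hL0.trans hx)
    linarith
  · obtain ⟨N₀, hN₀⟩ := clause_of_lower_height (n := n) (k := k) (m₀ := m₀) hn hlt c C
    refine ⟨max (max N₁ N₀) 2, fun N hN r hrC hroot _ => ?_⟩
    have hN1 : N₁ ≤ N := le_trans (le_trans (le_max_left _ _) (le_max_left _ _)) hN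
    have hN0 : N₀ ≤ N := le_trans (le_trans (le_max_right _ _) (le_max_left _ _)) hN
    have h2 : 2 ≤ N := le_trans (le_max_right _ _) hN
    have h := htr N hN1 r hroot
    have hx := le_logHt_xQ h2
    have hr := logHt_le_of_abs_le hrC
    refine hN₀ N hN0 r.den r.den_pos ?_
    have hn0' : (0 : ℝ) ≤ n := Nat.cast_nonneg n
    have hε0 : 0 ≤ 1 / (2 * (m₀ : ℝ)) := by positivity
    have hL0 : 0 ≤ (N ! : ℝ) * Real.log 2 := by positivity
    have e1 : (k : ℝ) * ((N ! : ℝ) * Real.log 2) ≤ k * logHt (xQ N) := mul_le_mul_of_nonneg_left hx hk0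
    have e2 : 0 ≤ 1 / (2 * (m₀ : ℝ)) * ((N ! : ℝ) * Real.log 2) := mul_nonneg hε0 hL0
    have e3 : (n : ℝ) * logHt r ≤ n * (Real.log (max C 1) + Real.log (r.den : ℝ)) :=
      mul_le_mul_of_nonneg_left hr hn0'
    have e4 : ((k : ℝ) - 1 / (2 * m₀)) * ((N ! : ℝ) * Real.log 2) =
        k * ((N ! : ℝ) * Real.log 2) - 1 / (2 * (m₀ : ℝ)) * ((N ! : ℝ) * Real.log 2) := by ring
    linarith

/-- **upper tail** — if at every rational point of every large level `n·h(r) ≤ k·h(x_N) + c`, then for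
`m₀·k < n` (`m₀ ≥ 1`) the clause can only hold vacuously: `ThinFibreAt m₀ P ⇒ BddLevelEmpty P`. -/
theorem bddLevelEmpty_of_thinFibreAt_of_transfer {P : ℤ[X][X]} {n k : ℕ} {c : ℝ} {N₁ : ℕ}
    (htr : ∀ N : ℕ, N₁ ≤ N → ∀ r : ℚ, bev P (partialSum 2 N) r = 0 →
      (n : ℝ) * logHt r ≤ k * logHt (xQ N) + c)
    {m₀ : ℕ} (hm : 1 ≤ m₀) (hlt : m₀ * k < n) (hT : ThinFibreAt m₀ P) : BddLevelEmpty P := by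
  intro C
  obtain ⟨N₂, hN₂⟩ := hT (max C 1)
  obtain ⟨N₀, hN₀⟩ := not_clause_of_upper_height (n := n) (k := k) (m₀ := m₀) hm hlt c (le_max_right C 1)
  refine ⟨max (max N₁ N₀) (max N₂ 2), fun N hN r hrC hroot hnd => ?_⟩
  have hN1 : N₁ ≤ N := le_trans (le_trans (le_max_left _ _) (le_max_left _ _)) hN
  have hN0 : N₀ ≤ N := le_trans (le_trans (le_max_right _ _) (le_max_left _ _)) hN
  have hN2' : N₂ ≤ N := le_trans (le_trans (le_max_left _ _) (le_max_right _ _)) hN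
  have h2 : 2 ≤ N := le_trans (le_trans (le_max_right _ _) (le_max_right _ _)) hN
  have hrC' : |(r : ℝ)| ≤ max C 1 := hrC.trans (le_max_left _ _)
  have hcl := hN₂ N hN2' r hrC' hroot hnd
  refine hN₀ N hN0 r.den r.den_pos ?_ hcl
  have h := htr N hN1 r hroot
  have hup := logHt_xQ_le h2
  have hrlow := log_den_le_logHt r
  have hk0 : (0 : ℝ) ≤ k := Nat.cast_nonneg k
  have hn0 : (0 : ℝ) ≤ n := Nat.cast_nonneg n
  have hε0 : 0 ≤ 1 / (2 * (m₀ : ℝ)) := by positivity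
  have hl2 : 0 ≤ Real.log 2 := Real.log_nonneg one_le_two
  have hL0 : 0 ≤ (N ! : ℝ) * Real.log 2 + Real.log 2 := by positivity
  have e1 : (n : ℝ) * Real.log (r.den : ℝ) ≤ n * logHt r := mul_le_mul_of_nonneg_left hrlow hn0
  have e2 : (k : ℝ) * logHt (xQ N) ≤ k * ((N ! : ℝ) * Real.log 2 + Real.log 2) :=
    mul_le_mul_of_nonneg_left hup hk0
  have e3 : 0 ≤ 1 / (2 * (m₀ : ℝ)) * ((N ! : ℝ) * Real.log 2 + Real.log 2) := mul_nonneg hε0 hL0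
  have e4 : ((k : ℝ) + 1 / (2 * m₀)) * ((N ! : ℝ) * Real.log 2 + Real.log 2) =
      k * ((N ! : ℝ) * Real.log 2 + Real.log 2) + 1 / (2 * (m₀ : ℝ)) * ((N ! : ℝ) * Real.log 2 + Real.log 2) := by
    ring
  linarith

/-- **boundary tail, arithmetic** (exact transfer, NO ε-room): if `n·log d ≤ k·(N!·log 2 + log 2) + c` with `1 ≤ k`
and `m₀·k ≤ n` (boundary `m₀·k = n` INCLUDED), then for large `N` the clause `C·2^{(N+1)!} < d^{m₀N}` FAILS (`C ≥ 1`):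
the room is `(N−1)! → ∞` — `m₀N·log d ≤ N·N!·log 2 + N·(log 2 + |c|) < (N+1)!·log 2`. -/
theorem not_clause_of_upper_height_le {n k m₀ : ℕ} (hk : 1 ≤ k) (hle : m₀ * k ≤ n) (c : ℝ) {C : ℝ} (hC : 1 ≤ C) :
    ∃ N₀ : ℕ, ∀ N : ℕ, N₀ ≤ N → ∀ d : ℕ, 1 ≤ d →
      (n : ℝ) * Real.log (d : ℝ) ≤ (k : ℝ) * ((N ! : ℝ) * Real.log 2 + Real.log 2) + c →
      ¬ (C * 2 ^ (N + 1)! < (d : ℝ) ^ (m₀ * N)) := by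
  obtain ⟨N₁, hN₁⟩ := eventually_le_factorial_log (Real.log 2 + |c|)
  refine ⟨N₁ + 1, fun N hN d hd hineq hcl => ?_⟩
  obtain ⟨M, rfl⟩ : ∃ M, N = M + 1 := ⟨N - 1, by omega⟩
  have hM : N₁ ≤ M := by omega
  have hB : Real.log 2 + |c| ≤ (M ! : ℝ) * Real.log 2 := hN₁ M hM
  have hl2pos : 0 < Real.log 2 := Real.log_pos one_lt_two
  have hd0 : (0 : ℝ) < d := by exact_mod_cast hd
  have hlogd : 0 ≤ Real.log (d : ℝ) := Real.log_nonneg (by exact_mod_cast hd)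
  have hC0 : 0 < C := by linarith
  have hlogC : 0 ≤ Real.log C := Real.log_nonneg hC
  have hcl' := hcl
  rw [← Real.log_lt_log_iff (by positivity) (by positivity), Real.log_mul hC0.ne' (by positivity), Real.log_pow,
    Real.log_pow] at hcl'
  push_cast at hcl'
  have hf2 : (((M + 1 + 1)! : ℕ) : ℝ) = ((M : ℝ) + 2) * (((M : ℝ) + 1) * (M ! : ℝ)) := by
    rw [Nat.factorial_succ, Nat.factorial_succ]; push_cast; ring
  have hf1 : (((M + 1)! : ℕ) : ℝ) = ((M : ℝ) + 1) * (M ! : ℝ) := by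
    rw [Nat.factorial_succ]; push_cast; ring
  rw [hf2] at hcl'
  rw [hf1] at hineq
  set X : ℝ := Real.log (d : ℝ) with hX
  set F : ℝ := (M ! : ℝ) with hF
  set l : ℝ := Real.log 2 with hl
  have hk0 : (1 : ℝ) ≤ k := by exact_mod_cast hk
  have hkpos : (0 : ℝ) < k := by linarith
  have hmk : (m₀ : ℝ) * k ≤ n := by exact_mod_cast hle
  have hM1 : (0 : ℝ) < (M : ℝ) + 1 := by positivity
  have hF0 : 0 ≤ F := Nat.cast_nonneg _
  have hcabs : c ≤ |c| := le_abs_self c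
  -- the clause × k :  k·(log C + (M+2)(M+1)·M!·log 2) < k·(m₀(M+1)·log d)
  have h1 : (k : ℝ) * (Real.log C + ((M : ℝ) + 2) * (((M : ℝ) + 1) * F) * l) <
      (k : ℝ) * ((m₀ : ℝ) * ((M : ℝ) + 1) * X) := by
    have := mul_lt_mul_of_pos_left hcl' hkpos
    convert this using 2
  -- the transfer × (M+1) :  (M+1)·(n·log d) ≤ (M+1)·(k((M+1)·M!·log 2 + log 2) + |c|)
  have h2 : ((M : ℝ) + 1) * ((n : ℝ) * X) ≤ ((M : ℝ) + 1) * ((k : ℝ) * (((M : ℝ) + 1) * F * l + l) + |c|) :=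
    mul_le_mul_of_nonneg_left (by linarith) hM1.le
  -- m₀·k ≤ n, times (M+1)·log d ≥ 0
  have h3 : ((M : ℝ) + 1) * X * ((m₀ : ℝ) * k) ≤ ((M : ℝ) + 1) * X * n :=
    mul_le_mul_of_nonneg_left hmk (by positivity)
  -- the room: (M+1)·k·(M!·log 2) ≥ (M+1)·k·(log 2 + |c|) ≥ (M+1)·(k·log 2 + |c|)
  have h4 : ((M : ℝ) + 1) * (k : ℝ) * (l + |c|) ≤ ((M : ℝ) + 1) * (k : ℝ) * (F * l) :=
    mul_le_mul_of_nonneg_left (by linarith) (by positivity)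
  have h5 : ((M : ℝ) + 1) * |c| ≤ ((M : ℝ) + 1) * ((k : ℝ) * |c|) :=
    mul_le_mul_of_nonneg_left (le_mul_of_one_le_left (abs_nonneg c) hk0) hM1.le
  have h6 : 0 ≤ (k : ℝ) * Real.log C := by positivity
  nlinarith [h1, h2, h3, h4, h5, h6]

/-- **boundary tail** — if at every rational point of every large level `n·h(r) ≤ k·h(x_N) + c` with `1 ≤ k` and
`m₀·k ≤ n` (boundary INCLUDED, every `m₀`), the clause can only hold vacuously: `ThinFibreAt m₀ P ⇒ BddLevelEmpty P`. -/
theorem bddLevelEmpty_of_thinFibreAt_of_transfer_le {P : ℤ[X][X]} {n k : ℕ} {c : ℝ} {N₁ : ℕ}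
    (htr : ∀ N : ℕ, N₁ ≤ N → ∀ r : ℚ, bev P (partialSum 2 N) r = 0 →
      (n : ℝ) * logHt r ≤ k * logHt (xQ N) + c)
    (hk : 1 ≤ k) {m₀ : ℕ} (hle : m₀ * k ≤ n) (hT : ThinFibreAt m₀ P) : BddLevelEmpty P := by
  intro C
  obtain ⟨N₂, hN₂⟩ := hT (max C 1)
  obtain ⟨N₀, hN₀⟩ := not_clause_of_upper_height_le (n := n) (k := k) (m₀ := m₀) hk hle c (le_max_right C 1)
  refine ⟨max (max N₁ N₀) (max N₂ 2), fun N hN r hrC hroot hnd => ?_⟩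
  have hN1 : N₁ ≤ N := le_trans (le_trans (le_max_left _ _) (le_max_left _ _)) hN
  have hN0 : N₀ ≤ N := le_trans (le_trans (le_max_right _ _) (le_max_left _ _)) hN
  have hN2' : N₂ ≤ N := le_trans (le_trans (le_max_left _ _) (le_max_right _ _)) hN
  have h2 : 2 ≤ N := le_trans (le_trans (le_max_right _ _) (le_max_right _ _)) hN
  have hrC' : |(r : ℝ)| ≤ max C 1 := hrC.trans (le_max_left _ _)
  have hcl := hN₂ N hN2' r hrC' hroot hnd
  refine hN₀ N hN0 r.den r.den_pos ?_ hcl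
  have h := htr N hN1 r hroot
  have hup := logHt_xQ_le h2
  have hrlow := log_den_le_logHt r
  have hk0 : (0 : ℝ) ≤ k := Nat.cast_nonneg k
  have hn0 : (0 : ℝ) ≤ n := Nat.cast_nonneg n
  have e1 : (n : ℝ) * Real.log (r.den : ℝ) ≤ n * logHt r := mul_le_mul_of_nonneg_left hrlow hn0
  have e2 : (k : ℝ) * logHt (xQ N) ≤ k * ((N ! : ℝ) * Real.log 2 + Real.log 2) :=
    mul_le_mul_of_nonneg_left hup hk0
  linarith

/-- the degree data `max(deg p, deg q) = n` unpacked. -/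
theorem degs_of_max_eq {p q : ℚ[X]} {n : ℕ} (h : max p.natDegree q.natDegree = n) :
    p.natDegree ≤ n ∧ q.natDegree ≤ n ∧ (p.natDegree = n ∨ q.natDegree = n) := by
  refine ⟨h ▸ le_max_left _ _, h ▸ le_max_right _ _, ?_⟩
  rcases max_choice p.natDegree q.natDegree with h' | h'
  · exact Or.inl (h'.symm.trans h)
  · exact Or.inr (h'.symm.trans h)

/-- the one-sided height inequalities from the degree data `max(deg p, deg q) = n`. -/
theorem logHt_div_bounds' {p q : ℚ[X]} (hpq : IsCoprime p q) {n : ℕ} (h : max p.natDegree q.natDegree = n) :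
    ∃ C : ℝ, ∀ t : ℚ, (n : ℝ) * logHt t - C ≤ logHt (aeval t p / aeval t q) ∧
      logHt (aeval t p / aeval t q) ≤ n * logHt t + C := by
  obtain ⟨hp, hq, hn⟩ := degs_of_max_eq h
  exact logHt_div_bounds hpq hp hq hn

end Summit.Schanuel.Schanuel.Theorems.RootDecomp1KHeightMachine

end
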